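import Summits.Schanuel.Schanuel.Theses.RootDecomp1B

/-!
# RootDecomp1B — round-5 glue «PolarBudgetHypotenuse»: `TightBudgetCoupling → NoSlackFirstFailure → NoDoublyDependentFirstFailure`

Proves the D-0019 glue item `NoDoublyDependentFirstFailureGlue` (stmt-Schanuel-29190) of the split of the round-4 residual
`NoDoublyDependentFirstFailure` (stmt-Schanuel-28105) into `TightBudgetCoupling` (stmt-Schanuel-29188, σ = 0: on the hypotenuse of
the budget triangle) and `NoSlackFirstFailure` (stmt-Schanuel-29189, σ ≥ 1: the declared residual of round 5) — pure case split on
`a + b ≤ 2m + ρ` vs `2m + ρ < a + b` — together with the exactness record `noDoublyDependentFirstFailure_iff_hypotenuse :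
DD ⟺ Tight ∧ NoSlack` and the pedigree from `NoEntangledFirstFailure` (stmt-Schanuel-27215).  Port of the lens-4 gen-5 hand-off
`HOME/decomp-schanuel-lens-4/g5/prover/RootDecomp1BBudgetHypotenuse.port.lean` by the census seat (prover role): the two LOCAL COPY
defs deleted (the decls are route constants since rev 10–12), the glue theorem retyped on the route's glue decl; this file defines
nothing; 0 sorry.
-/

set_option linter.dupNamespace false

namespace Summit.Schanuel.Schanuel.Theorems.RootDecomp1BBudgetHypotenuse

open Summit.Schanuel.Schanuel.Theses.RootDecomp1B

/-- THE GLUE ITEM of the round-5 split: Tight → Slack → DD.  At a doubly-dependent first failure with budget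
`2m + ρ ≤ a + b`, either `a + b ≤ 2m + ρ` (σ = 0: TightBudgetCoupling concludes) or `2m + ρ < a + b`, i.e.
`2m + ρ + 1 ≤ a + b` on cardinals (σ ≥ 1: NoSlackFirstFailure concludes). -/
theorem noDoublyDependentFirstFailureGlue_holds : NoDoublyDependentFirstFailureGlue :=
  fun hTight hSlack m r hr hIH hB ha hb hT3 =>
    (le_or_gt _ _).elim (fun hσ => hTight m r hr hIH hB ha hb hσ hT3)
      (fun hσ => hSlack m r hr hIH hB ha hb (Cardinal.add_one_le_of_lt hσ) hT3)

/-- DD → Tight (drop the hypotenuse hypothesis). -/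
theorem tightBudgetCoupling_of_noDoublyDependent (hDD : NoDoublyDependentFirstFailure) :
    TightBudgetCoupling :=
  fun m r hr hIH hB ha hb _ hT3 => hDD m r hr hIH hB ha hb hT3

/-- DD → Slack (drop the slack hypothesis). -/
theorem noSlackFirstFailure_of_noDoublyDependent (hDD : NoDoublyDependentFirstFailure) :
    NoSlackFirstFailure :=
  fun m r hr hIH hB ha hb _ hT3 => hDD m r hr hIH hB ha hb hT3

/-- The round-5 cut is EXACT: DD ⟺ Tight ∧ Slack. -/
theorem noDoublyDependentFirstFailure_iff_hypotenuse :
    NoDoublyDependentFirstFailure ↔ TightBudgetCoupling ∧ NoSlackFirstFailure :=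
  ⟨fun h => ⟨tightBudgetCoupling_of_noDoublyDependent h, noSlackFirstFailure_of_noDoublyDependent h⟩,
    fun h => noDoublyDependentFirstFailureGlue_holds h.1 h.2⟩

/-- Pedigree: the round-3 residual P5 (stmt-Schanuel-27215) implies DD (drop the two side-defect hypotheses),
hence both round-5 pieces. -/
theorem noDoublyDependentFirstFailure_of_noEntangled (h5 : NoEntangledFirstFailure) :
    NoDoublyDependentFirstFailure :=
  fun m r hr hIH hB _ _ hT3 => h5 m r hr hIH hB hT3

/-- Pedigree: P5 27215 ⟹ TightBudgetCoupling. -/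
theorem tightBudgetCoupling_of_noEntangled (h5 : NoEntangledFirstFailure) : TightBudgetCoupling :=
  tightBudgetCoupling_of_noDoublyDependent (noDoublyDependentFirstFailure_of_noEntangled h5)

/-- Pedigree: P5 27215 ⟹ NoSlackFirstFailure. -/
theorem noSlackFirstFailure_of_noEntangled (h5 : NoEntangledFirstFailure) : NoSlackFirstFailure :=
  noSlackFirstFailure_of_noDoublyDependent (noDoublyDependentFirstFailure_of_noEntangled h5)

end Summit.Schanuel.Schanuel.Theorems.RootDecomp1BBudgetHypotenuse
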